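import Summits.QuantumFields.QCD.Theorems.PauliWegnerSeaFMClosureUnquenchedSideWitnessC1Aux1
import Summits.QuantumFields.QCD.Theorems.PauliWegnerSeaFMClosureUnquenchedSideWitnessC1Aux2

/-!
# Side witness, part 3: the flow matrix is nonsingular

Crux `FMClosureUnquenched` (stmt-QuantumFields-11512), line `von-mises-circles`, registered sub-goal
`c1_sideWitness : SideWitness`.

For a side `A ⊆ (ℤ/N)⁴` carrying a flow (`σ, d`: the two out-edges of a site and their labels;
`π, e`: the two in-edges) and a signed link-exponent field `a` whose hop exponents `LEXP a x ℓ` are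
`+1` exactly on the flow edges leaving `x` and `-1` exactly on the reversed flow edges entering `x`,
the `t⁰`-coefficient `FLOWMAT A a m₀ 0` of the row-scaled, diagonally twisted side matrix is
nonsingular (`det_flowMatrix_ne_zero`, = registered `c1_sideWitness_aux3`): a kernel vector vanishes
off `A` (identity block), its colour-`0,1` components solve the flow-row equations of
`flow_kernel` (Aux1) and its colour-`2` component those of the reversed flow.
-/

namespace Summit.QuantumFields.QCD.Theorems.VonMisesCirclesC1

open Matrix Literature.MathematicalPhysics.QuantumLattice Literature.Probability.LatticeModels
open Summit.QuantumFields.QCD.Theorems.VonMisesCircles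

set_option quotPrecheck false in
set_option hygiene false in
/-- The unit step `±e_μ` of label `ℓ = (μ, b)` on the torus `(ℤ/N)⁴`. -/
local notation "STEP" ℓ:arg =>
  (if Prod.snd ℓ then -(Pi.single (Prod.fst ℓ) 1 : TorusSite 4 N) else Pi.single (Prod.fst ℓ) 1)

set_option quotPrecheck false in
/-- The chiral hopping projector of label `ℓ`: `½(1 + γ_μ)` backward, `½(1 - γ_μ)` forward. -/
local notation "PROJ" ℓ:arg =>
  (if Prod.snd ℓ then chiralProjPlus (Prod.fst ℓ) else chiralProjMinus (Prod.fst ℓ))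

set_option quotPrecheck false in
/-- Exponent of `t` in the row-scaled twisted hop of signed link exponent `n` seen by colour `c`. -/
local notation "EXPF" c:arg n:arg =>
  (if n = (1 : ℤ) then (if c = (2 : Fin 3) then (4 : ℕ) else 0)
    else if n = (-1 : ℤ) then (if c = (2 : Fin 3) then (0 : ℕ) else 2)
    else (if c = (2 : Fin 3) then (2 : ℕ) else 1))

set_option quotPrecheck false in
set_option hygiene false in
/-- The signed link exponent seen by the hop `x → x + STEP ℓ` for the exponent field `a`. -/
local notation "LEXP" a:arg x:arg ℓ:arg =>
  (if Prod.snd ℓ then -(a (x + STEP ℓ) (Prod.fst ℓ)) else a x (Prod.fst ℓ))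

set_option quotPrecheck false in
set_option hygiene false in
/-- The `t^k`-coefficient of the row-scaled twisted side matrix (flow matrix for `k = 0`). -/
local notation "FLOWMAT" A:arg a:arg m₀:arg k:arg =>
  (Matrix.of fun (p q : QIdx N) =>
    if p.1 ∈ A ∧ q.1 ∈ A then
      (if p = q ∧ (if p.2.1 = (2 : Fin 3) then (2 : ℕ) else 1) = k then (((m₀ : ℝ) + 4 : ℝ) : ℂ) else 0) -
        ∑ ℓ : Fin 4 × Bool, (if q.1 = p.1 + STEP ℓ ∧ p.2.1 = q.2.1 ∧ EXPF p.2.1 (LEXP a p.1 ℓ) = k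
          then (PROJ ℓ) p.2.2 q.2.2 else 0)
    else (if p = q ∧ k = (0 : ℕ) then (1 : ℂ) else 0))

/-! ## Small tools -/

/-- The sum over labels of the indicator of a pair. -/
theorem sum_label_pair {V : Type*} [AddCommMonoid V] (F : Fin 4 × Bool → V) {ℓ₀ ℓ₁ : Fin 4 × Bool}
    (h : ℓ₀ ≠ ℓ₁) :
    ∑ ℓ : Fin 4 × Bool, (if ℓ = ℓ₀ ∨ ℓ = ℓ₁ then F ℓ else 0) = F ℓ₀ + F ℓ₁ := by
  have key : ∀ ℓ, (if ℓ = ℓ₀ ∨ ℓ = ℓ₁ then F ℓ else 0) =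
      (if ℓ = ℓ₀ then F ℓ else 0) + (if ℓ = ℓ₁ then F ℓ else 0) := by
    intro ℓ
    by_cases h0 : ℓ = ℓ₀
    · subst h0; simp [h]
    · by_cases h1 : ℓ = ℓ₁
      · subst h1; simp [h0]
      · simp [h0, h1]
  simp_rw [key]
  rw [Finset.sum_add_distrib, Finset.sum_ite_eq', Finset.sum_ite_eq']
  simp

/-- Opposite steps cancel: `STEP ℓ̄ + STEP ℓ = 0`. -/
theorem step_rev_add_step {N : ℕ} (ℓ : Fin 4 × Bool) :
    STEP ((ℓ.1, !ℓ.2) : Fin 4 × Bool) + STEP ℓ = 0 := by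
  obtain ⟨μ, b⟩ := ℓ
  cases b <;> simp

/-- Opposite steps cancel: `STEP ℓ + STEP ℓ̄ = 0`. -/
theorem step_add_step_rev {N : ℕ} (ℓ : Fin 4 × Bool) :
    STEP ℓ + STEP ((ℓ.1, !ℓ.2) : Fin 4 × Bool) = 0 := by
  obtain ⟨μ, b⟩ := ℓ
  cases b <;> simp

/-- For colours `0, 1` the hop exponent vanishes exactly on flow edges (`n = 1`). -/
theorem expf_eq_zero_iff_of_ne_two {c : Fin 3} (hc : c ≠ 2) (n : ℤ) : (EXPF c n) = 0 ↔ n = 1 := by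
  by_cases h1 : n = 1
  · simp [h1, hc]
  · by_cases h2 : n = -1
    · simp [h2, hc]
    · simp [h1, h2, hc]

/-- For colour `2` the hop exponent vanishes exactly on reversed flow edges (`n = -1`). -/
theorem expf_two_eq_zero_iff (n : ℤ) : (EXPF (2 : Fin 3) n) = 0 ↔ n = -1 := by
  by_cases h1 : n = 1
  · subst h1; norm_num
  · by_cases h2 : n = -1
    · simp [h2]
    · simp [h1, h2]

/-- Collapsing a quark-index sum concentrated on one site and one colour. -/
theorem sum_qidx_single {N : ℕ} [NeZero N] (y₀ : TorusSite 4 N) (c : Fin 3) (R : Prop) [Decidable R]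
    (G : Fin 4 → ℂ) (w : QIdx N → ℂ) :
    ∑ q : QIdx N, (if q.1 = y₀ ∧ c = q.2.1 ∧ R then G q.2.2 else 0) * w q =
      if R then ∑ β : Fin 4, G β * w (y₀, c, β) else 0 := by
  by_cases hR : R
  · simp only [hR, and_true, if_true]
    rw [Fintype.sum_prod_type]
    rw [Finset.sum_eq_single y₀]
    · rw [Fintype.sum_prod_type, Finset.sum_eq_single c]
      · simp
      · intro c' _ hc'
        simp [Ne.symm hc']
      · simp
    · intro y _ hy
      simp [hy]
    · simp
  · simp [hR]

/-! ## Rows of the flow matrix -/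

/-- **Rows of the flow matrix**: identity off `A`; on `A`, minus the sum over the hops `x → x + STEP ℓ`
inside `A` with vanishing exponent of the projector `P(ℓ)` applied to the target spinor. -/
theorem flowMatrix_zero_mulVec {N : ℕ} [NeZero N] (A : Finset (TorusSite 4 N))
    (a : TorusSite 4 N → Fin 4 → ℤ) (m₀ : ℝ) (w : QIdx N → ℂ) (p : QIdx N) :
    ((FLOWMAT A a m₀ 0) *ᵥ w) p =
      if p.1 ∈ A then
        -∑ ℓ : Fin 4 × Bool, (if p.1 + STEP ℓ ∈ A ∧ EXPF p.2.1 (LEXP a p.1 ℓ) = 0 then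
            ((PROJ ℓ) *ᵥ fun β => w (p.1 + STEP ℓ, p.2.1, β)) p.2.2 else 0)
      else w p := by
  simp only [mulVec, dotProduct, Matrix.of_apply]
  by_cases hp : p.1 ∈ A
  · rw [if_pos hp]
    -- the diagonal coefficient is absent at `k = 0`
    have hdiag : ∀ q : QIdx N, (if p = q ∧ (if p.2.1 = (2 : Fin 3) then (2 : ℕ) else 1) = 0
        then (((m₀ : ℝ) + 4 : ℝ) : ℂ) else 0) = 0 := by
      intro q
      have hne : ¬((if p.2.1 = (2 : Fin 3) then (2 : ℕ) else 1) = 0) := by split_ifs <;> decide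
      rw [if_neg (fun h => hne h.2)]
    -- rewrite every summand
    have hsum : ∀ q : QIdx N,
        (if p.1 ∈ A ∧ q.1 ∈ A then
          (if p = q ∧ (if p.2.1 = (2 : Fin 3) then (2 : ℕ) else 1) = 0 then (((m₀ : ℝ) + 4 : ℝ) : ℂ) else 0) -
            ∑ ℓ : Fin 4 × Bool, (if q.1 = p.1 + STEP ℓ ∧ p.2.1 = q.2.1 ∧ EXPF p.2.1 (LEXP a p.1 ℓ) = 0
              then (PROJ ℓ) p.2.2 q.2.2 else 0)
          else (if p = q ∧ True then (1 : ℂ) else 0)) * w q =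
        -∑ ℓ : Fin 4 × Bool, ((if q.1 = p.1 + STEP ℓ ∧ p.2.1 = q.2.1 ∧
            (p.1 + STEP ℓ ∈ A ∧ EXPF p.2.1 (LEXP a p.1 ℓ) = 0) then (PROJ ℓ) p.2.2 q.2.2 else 0) * w q) := by
      intro q
      by_cases hq : q.1 ∈ A
      · rw [if_pos ⟨hp, hq⟩, hdiag, zero_sub, neg_mul, Finset.sum_mul]
        congr 1
        refine Finset.sum_congr rfl fun ℓ _ => ?_
        congr 1
        refine if_congr ⟨fun h => ⟨h.1, h.2.1, ?_, h.2.2⟩, fun h => ⟨h.1, h.2.1, h.2.2.2⟩⟩ rfl rfl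
        rw [← h.1]
        exact hq
      · have hpq : ¬(p = q ∧ True) := fun h => hq (h.1 ▸ hp)
        rw [if_neg (fun h => hq h.2), if_neg hpq, zero_mul]
        symm
        rw [neg_eq_zero]
        refine Finset.sum_eq_zero fun ℓ _ => ?_
        rw [if_neg, zero_mul]
        intro h
        apply hq
        rw [h.1]
        exact h.2.2.1
    refine (Finset.sum_congr rfl fun q _ => hsum q).trans ?_
    rw [Finset.sum_neg_distrib, Finset.sum_comm]
    congr 1
    refine Finset.sum_congr rfl fun ℓ _ => ?_
    rw [sum_qidx_single (p.1 + STEP ℓ) p.2.1 (p.1 + STEP ℓ ∈ A ∧ EXPF p.2.1 (LEXP a p.1 ℓ) = 0)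
      (fun β => (PROJ ℓ) p.2.2 β) w]
  · rw [if_neg hp]
    have hsum : ∀ q : QIdx N,
        (if p.1 ∈ A ∧ q.1 ∈ A then
          (if p = q ∧ (if p.2.1 = (2 : Fin 3) then (2 : ℕ) else 1) = 0 then (((m₀ : ℝ) + 4 : ℝ) : ℂ) else 0) -
            ∑ ℓ : Fin 4 × Bool, (if q.1 = p.1 + STEP ℓ ∧ p.2.1 = q.2.1 ∧ EXPF p.2.1 (LEXP a p.1 ℓ) = 0
              then (PROJ ℓ) p.2.2 q.2.2 else 0)
          else (if p = q ∧ True then (1 : ℂ) else 0)) * w q =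
        if p = q then w q else 0 := by
      intro q
      rw [if_neg (fun h => hp h.1)]
      by_cases h : p = q
      · rw [if_pos ⟨h, trivial⟩, if_pos h, one_mul]
      · rw [if_neg (fun h' => h h'.1), if_neg h, zero_mul]
    refine (Finset.sum_congr rfl fun q _ => hsum q).trans ?_
    rw [Finset.sum_ite_eq]
    simp

/-! ## The flow matrix is nonsingular -/

/-- **The flow matrix is nonsingular** (registered `c1_sideWitness_aux3`). -/
theorem det_flowMatrix_ne_zero {N : ℕ} [NeZero N] (A : Finset (TorusSite 4 N)) (m₀ : ℝ)
    (a : TorusSite 4 N → Fin 4 → ℤ)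
    (σ π : Fin 2 → TorusSite 4 N → TorusSite 4 N) (d e : Fin 2 → TorusSite 4 N → Fin 4 × Bool)
    (hσ : ∀ x ∈ A, ∀ i : Fin 2, σ i x ∈ A ∧ σ i x = x + STEP (d i x))
    (hd : ∀ x ∈ A, d 0 x ≠ d 1 x)
    (hπ : ∀ y ∈ A, ∀ j : Fin 2, π j y ∈ A ∧ π j y = y + STEP ((e j y).1, !(e j y).2) ∧
      ∃ i : Fin 2, d i (π j y) = e j y)
    (he : ∀ y ∈ A, e 0 y ≠ e 1 y)
    (hin : ∀ x ∈ A, ∀ i : Fin 2, ∃ j : Fin 2, π j (σ i x) = x ∧ e j (σ i x) = d i x)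
    (hL1 : ∀ x ∈ A, ∀ ℓ : Fin 4 × Bool, (LEXP a x ℓ) = 1 ↔ (ℓ = d 0 x ∨ ℓ = d 1 x))
    (hL2 : ∀ x ∈ A, ∀ ℓ : Fin 4 × Bool, (LEXP a x ℓ) = -1 ↔
      (ℓ = ((e 0 x).1, !(e 0 x).2) ∨ ℓ = ((e 1 x).1, !(e 1 x).2))) :
    (FLOWMAT A a m₀ 0).det ≠ 0 := by
  intro hdet
  obtain ⟨w, hw0, hw⟩ := Matrix.exists_mulVec_eq_zero_iff.2 hdet
  apply hw0
  -- the kernel vector vanishes off `A`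
  have hoff : ∀ p : QIdx N, p.1 ∉ A → w p = 0 := by
    intro p hp
    have h := congrFun hw p
    rw [flowMatrix_zero_mulVec, if_neg hp] at h
    exact h
  -- the row equations on `A`
  have hrow : ∀ p : QIdx N, p.1 ∈ A →
      ∑ ℓ : Fin 4 × Bool, (if p.1 + STEP ℓ ∈ A ∧ EXPF p.2.1 (LEXP a p.1 ℓ) = 0 then
        ((PROJ ℓ) *ᵥ fun β => w (p.1 + STEP ℓ, p.2.1, β)) p.2.2 else 0) = 0 := by
    intro p hp
    have h := congrFun hw p
    rw [flowMatrix_zero_mulVec, if_pos hp, Pi.zero_apply, neg_eq_zero] at h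
    exact h
  -- σ i (π j y) = y and π j (σ i x) = x bookkeeping
  have hσπ : ∀ y ∈ A, ∀ j : Fin 2, ∀ i : Fin 2, d i (π j y) = e j y → σ i (π j y) = y := by
    intro y hy j i hdi
    obtain ⟨hπA, hπeq, -⟩ := hπ y hy j
    rw [(hσ (π j y) hπA i).2, hdi, hπeq, add_assoc, step_rev_add_step, add_zero]
  -- colours 0 and 1: the flow-row equations
  have hcol : ∀ c : Fin 3, c ≠ 2 → ∀ y ∈ A, (fun β => w (y, c, β)) = 0 := by
    intro c hc
    refine flow_kernel A σ π d e hd ?_ he (fun y β => w (y, c, β)) ?_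
    · intro y hy j
      obtain ⟨hπA, _, i, hdi⟩ := hπ y hy j
      exact ⟨hπA, i, hσπ y hy j i hdi, hdi⟩
    · intro x hx
      ext α
      have h := hrow (x, c, α) hx
      have hind : ∀ ℓ : Fin 4 × Bool, (x + STEP ℓ ∈ A ∧ EXPF c (LEXP a x ℓ) = 0) ↔ (ℓ = d 0 x ∨ ℓ = d 1 x) := by
        intro ℓ
        rw [expf_eq_zero_iff_of_ne_two hc, hL1 x hx ℓ]
        constructor
        · exact fun h' => h'.2
        · intro h'
          refine ⟨?_, h'⟩
          rcases h' with h' | h'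
          · rw [h', ← (hσ x hx 0).2]; exact (hσ x hx 0).1
          · rw [h', ← (hσ x hx 1).2]; exact (hσ x hx 1).1
      have h' : ∑ ℓ : Fin 4 × Bool, (if ℓ = d 0 x ∨ ℓ = d 1 x then
          ((PROJ ℓ) *ᵥ fun β => w (x + STEP ℓ, c, β)) α else 0) = 0 :=
        (Finset.sum_congr rfl fun ℓ _ => if_congr (hind ℓ).symm rfl rfl).trans h
      rw [sum_label_pair (fun ℓ => ((PROJ ℓ) *ᵥ fun β => w (x + STEP ℓ, c, β)) α) (hd x hx)] at h'
      rw [← (hσ x hx 0).2, ← (hσ x hx 1).2] at h'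
      simpa using h'
  -- colour 2: the reversed flow
  have hcol2 : ∀ y ∈ A, (fun β => w (y, 2, β)) = 0 := by
    refine flow_kernel A π σ (fun j y => (((e j y).1, !(e j y).2) : Fin 4 × Bool))
      (fun i x => (((d i x).1, !(d i x).2) : Fin 4 × Bool)) ?_ ?_ ?_ (fun y β => w (y, 2, β)) ?_
    · intro y hy h
      apply he y hy
      simp only [Prod.mk.injEq, Bool.not_inj_iff] at h
      exact Prod.ext h.1 h.2
    · intro x hx i
      obtain ⟨j, hπσ, hej⟩ := hin x hx i
      refine ⟨(hσ x hx i).1, j, hπσ, ?_⟩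
      simp only [hej]
    · intro x hx h
      apply hd x hx
      simp only [Prod.mk.injEq, Bool.not_inj_iff] at h
      exact Prod.ext h.1 h.2
    · intro x hx
      ext α
      have h := hrow (x, 2, α) hx
      have hind : ∀ ℓ : Fin 4 × Bool, (x + STEP ℓ ∈ A ∧ EXPF (2 : Fin 3) (LEXP a x ℓ) = 0) ↔
          (ℓ = ((e 0 x).1, !(e 0 x).2) ∨ ℓ = ((e 1 x).1, !(e 1 x).2)) := by
        intro ℓ
        rw [expf_two_eq_zero_iff, hL2 x hx ℓ]
        constructor
        · exact fun h' => h'.2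
        · intro h'
          refine ⟨?_, h'⟩
          rcases h' with h' | h'
          · rw [h', ← (hπ x hx 0).2.1]; exact (hπ x hx 0).1
          · rw [h', ← (hπ x hx 1).2.1]; exact (hπ x hx 1).1
      have hne : (((e 0 x).1, !(e 0 x).2) : Fin 4 × Bool) ≠ ((e 1 x).1, !(e 1 x).2) := by
        intro h'
        apply he x hx
        simp only [Prod.mk.injEq, Bool.not_inj_iff] at h'
        exact Prod.ext h'.1 h'.2
      have h' : ∑ ℓ : Fin 4 × Bool, (if ℓ = ((e 0 x).1, !(e 0 x).2) ∨ ℓ = ((e 1 x).1, !(e 1 x).2) then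
          ((PROJ ℓ) *ᵥ fun β => w (x + STEP ℓ, 2, β)) α else 0) = 0 :=
        (Finset.sum_congr rfl fun ℓ _ => if_congr (hind ℓ).symm rfl rfl).trans h
      rw [sum_label_pair (fun ℓ => ((PROJ ℓ) *ᵥ fun β => w (x + STEP ℓ, 2, β)) α) hne] at h'
      rw [← (hπ x hx 0).2.1, ← (hπ x hx 1).2.1] at h'
      simpa using h'
  -- conclusion
  funext p
  obtain ⟨y, c, β⟩ := p
  by_cases hy : y ∈ A
  · by_cases hc : c = 2
    · subst hc
      exact congrFun (hcol2 y hy) β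
    · exact congrFun (hcol c hc y hy) β
  · exact hoff _ hy

/-- **Registered helper `c1_sideWitness_aux3` of crux stmt-QuantumFields-11512** (line `von-mises-circles`,
sub-goal `c1_sideWitness`): the flow matrix of a flow on a side is nonsingular. -/
theorem c1_sideWitness_aux3 : ∀ (N : ℕ) [NeZero N] (A : Finset (TorusSite 4 N)) (m₀ : ℝ) (a : TorusSite 4 N → Fin 4 → ℤ) (σ π : Fin 2 → TorusSite 4 N → TorusSite 4 N) (d e : Fin 2 → TorusSite 4 N → Fin 4 × Bool), (∀ x ∈ A, ∀ i : Fin 2, σ i x ∈ A ∧ σ i x = x + (if Prod.snd (d i x) then -(Pi.single (Prod.fst (d i x)) 1 : TorusSite 4 N) else Pi.single (Prod.fst (d i x)) 1)) → (∀ x ∈ A, d 0 x ≠ d 1 x) → (∀ y ∈ A, ∀ j : Fin 2, π j y ∈ A ∧ π j y = y + (if Prod.snd ((e j y).1, !(e j y).2) then -(Pi.single (Prod.fst ((e j y).1, !(e j y).2)) 1 : TorusSite 4 N) else Pi.single (Prod.fst ((e j y).1, !(e j y).2)) 1) ∧ ∃ i : Fin 2, d i (π j y) = e j y) → (∀ y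 ∈ A, e 0 y ≠ e 1 y) → (∀ x ∈ A, ∀ i : Fin 2, ∃ j : Fin 2, π j (σ i x) = x ∧ e j (σ i x) = d i x) → (∀ x ∈ A, ∀ ℓ : Fin 4 × Bool, (if Prod.snd ℓ then -(a (x + (if Prod.snd ℓ then -(Pi.single (Prod.fst ℓ) 1 : TorusSite 4 N) else Pi.single (Prod.fst ℓ) 1)) (Prod.fst ℓ)) else a x (Prod.fst ℓ)) = 1 ↔ (ℓ = d 0 x ∨ ℓ = d 1 x)) → (∀ x ∈ A, ∀ ℓ : Fin 4 × Bool, (if Prod.snd ℓ then -(a (x + (if Prod.snd ℓ then -(Pi.single (Prod.fst ℓ) 1 : TorusSite 4 N) else Pi.single (Prod.fst ℓ) 1)) (Prod.fst ℓ)) else a x (Prod.fst ℓ)) = -1 ↔ (ℓ = ((e 0 x).1, !(e 0 x).2) ∨ ℓ = ((e 1 x).1, !(e 1 x).2))) → ((Matrix.of fun (p q : QIdx N) => if p.1 ∈ A ∧ q.1 ∈ A then (if p = q ∧ (if p.2.1 = (2 : Fin 3) then (2 : ℕ) else 1) = 0 then (((m₀ : ℝ) + 4 : ℝ) : ℂ)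 else 0) - ∑ ℓ : Fin 4 × Bool, (if q.1 = p.1 + (if Prod.snd ℓ then -(Pi.single (Prod.fst ℓ) 1 : TorusSite 4 N) else Pi.single (Prod.fst ℓ) 1) ∧ p.2.1 = q.2.1 ∧ (if (if Prod.snd ℓ then -(a (p.1 + (if Prod.snd ℓ then -(Pi.single (Prod.fst ℓ) 1 : TorusSite 4 N) else Pi.single (Prod.fst ℓ) 1)) (Prod.fst ℓ)) else a p.1 (Prod.fst ℓ)) = (1 : ℤ) then (if p.2.1 = (2 : Fin 3) then (4 : ℕ) else 0) else if (if Prod.snd ℓ then -(a (p.1 + (if Prod.snd ℓ then -(Pi.single (Prod.fst ℓ) 1 : TorusSite 4 N) else Pi.single (Prod.fst ℓ) 1)) (Prod.fst ℓ)) else a p.1 (Prod.fst ℓ)) = (-1 : ℤ) then (if p.2.1 = (2 : Fin 3) then (0 : ℕ) else 2) else (if p.2.1 = (2 : Fin 3) then (2 : ℕ) else 1)) = 0 then (if Prod.snd ℓ then chiralProjPlus (Prod.fst ℓ) else chiralProjMinus (Prod.fst ℓ)) p.2.2 q.2.2 else 0) else (if p = q ∧ 0 = (0 : ℕ) then (1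 : ℂ) else 0))).det ≠ 0 :=
  fun _ _ A m₀ a σ π d e hσ hd hπ he hin hL1 hL2 =>
    det_flowMatrix_ne_zero A m₀ a σ π d e hσ hd hπ he hin hL1 hL2

end Summit.QuantumFields.QCD.Theorems.VonMisesCirclesC1
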